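import Mathlib.Analysis.Convex.Combination
import Summits.Ventures.Crystal3D.Theorems.StickyWulffConstantCoaxialWallLawCapCheckerLemmas
import HarnessLib

/-!
# Soundness lemmas (L3), (L4) and the cover ⇒ capacity bookkeeping for the certificate checker `capcc` (crux `CoaxialWallLaw`, stmt-Ventures-19481)

HONEST FRAMING. Venture `Summits/Ventures/Crystal3D` (cell `crystal3d-full`); helper `--supports` the crux `CoaxialWallLaw`
(stmt-Ventures-19481, `route-Ventures-StickyWulffConstant`), registered line 'CoaxialWallLawCertificates' (planner cf-p1, stub
`stub_lensCert`); companion of '…CapCheckerLemmas' ((L1) small caps, (L2) cell-in-cap), same setting and conventions (arbitrary real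
inner-product space `V`; blockers `w` with free condition `⟪u, w⟫ ≤ ‖w‖²/2`; witnesses unit, pairwise chord `≥ 1`).
* **(L3) pin lemma** (`capcc.pinned_exclusions`, PREREG (69.0⁶)(c) R4): `inner_le_pinThreshold_of_active` — `e, u` unit, `u ≠ e`, a blocker
  `w ≠ 0` ACTIVE at `e` (`⟪e, w⟫ = ‖w‖²/2`: the ball at `y + e` touches `y + w`) and respected by `u` (`⟪u, w⟫ ≤ ‖w‖²/2`) whose
  tangential push on `u` is at least `μ ≥ 0` (`μ‖t‖·‖w‖²/2 ≤ ⟪t, w⟫`, `t = u − ⟪u, e⟫e`) forces `⟪u, e⟫ ≤ (1 − μ²)/(1 + μ²)` (angle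
  `≥ 2 arctan μ`); **`inner_le_pinThreshold`** — the same from the SUPPORT form «every tangent vector `d ⊥ e`, `d ≠ 0`, is pushed by some
  active blocker: `μ‖d‖‖w‖²/2 ≤ ⟪d, w⟫`» (`inner_le_pinThreshold_sq`: the squared, root-free variant with `ν = μ²`);
  `inner_le_pinThreshold_of_disc_subset_hull` — the same from cf-p2's phrasing «the convex hull of the scaled tangential parts
  `a_w = (2/‖w‖²)(w − ⟪w, e⟫e)` of the active blockers contains the tangent disc of radius `μ`» (`0` strictly inside the tangent hull,
  in-radius `μ`); `eq_of_mem_pinCap` — contrapositive: the open pin cap `{x : (1 − μ²)/(1 + μ²) < ⟪x, e⟫}` contains no free unit vector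
  other than `e` (a forbidden direction, hence no witness).
* **(L4) cross-cell conflict** (`capcc.cells_conflict`): `le_inner_sum_smul_sum_smul` (a bilinear lower bound `m ≤ ⟪p_i, q_j⟫` at corner
  pairs passes to pairs of convex combinations), `norm_mul_norm_lt_two_inner_of_test` (`0 < m ≤ ⟪v, w⟫`, `‖v‖² ≤ M_a`, `‖w‖² ≤ M_b`,
  `M_a M_b < 4m²` ⇒ `‖v‖‖w‖ < 2⟪v, w⟫`), `inner_normalize_gt_half` / `norm_normalize_sub_normalize_lt_one`, assembled as **`cellsConflict`**:
  every direction of the first cell is within chord distance `< 1` of every direction of the second.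
* Top level: **`card_le_of_capCover`** — if every unit vector lies in an open blocker cap, an open pin cap or one of `k` closed small caps,
  a `1`-separated finite family of free unit vectors avoiding the pin directions has `≤ k` members; **`card_le_of_patches`** — the
  patch/clique refinement of `capcc.patch_bound` (occupied patches are pairwise non-conflicting).
Proofs: (L3) by `u = ⟪u, e⟫e + t`, `‖t‖² = 1 − ⟪u, e⟫²`, `⟪t, w⟫ ≤ (1 − ⟪u, e⟫)‖w‖²/2`, so `μ‖t‖ ≤ 1 − ⟪u, e⟫`, squared and divided by
`1 − ⟪u, e⟫ > 0`; the hull form pairs a convex combination with the unit tangent (`Finset.mem_convexHull'`); (L4) by the (L2) tools.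
REMARK for the checker's pin record (see NOTES of seat 19481-w2): the support form must be certified with ORIENTATION — e.g. a ccw (about
`e`) cyclic list of active blockers with `det(e, a_i, a_{i+1}) > 0` and edge lines at squared distance `≥ ν` from `0`; the orientation-free
variant «`0 = Σ λ_i a_i` convex + chain edge lines at distance `≥ μ`» is UNSOUND (planar counterexample `(0.1, 1), (−3, 2), (0.1, −1), (−3, −2)`
in chain order: edge distances `≥ 0.65`, support in direction `(1, 0)` only `0.1`).  That `E³` certificate lemma is a separate file.
WHAT THIS IS NOT: not the checker; no statement about types, tables or packings; F-C1 not moved.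
-/

namespace Summit.Ventures.Crystal3D.Theorems

namespace CapChecker

open Finset
open scoped InnerProductSpace

variable {V : Type*} [NormedAddCommGroup V] [InnerProductSpace ℝ V]

/-! ### (L3) The pin lemma -/

/-- `(1 − μ²)/(1 + μ²) ≥ −1`: the pin threshold never excludes the antipode. -/
theorem neg_one_le_pinThreshold (μ : ℝ) : -1 ≤ (1 - μ ^ 2) / (1 + μ ^ 2) := by
  rw [le_div_iff₀ (by positivity)]
  nlinarith [sq_nonneg μ]

/-- **(L3) pin lemma, one active blocker.**  `e, u` unit vectors, `u ≠ e`; `w ≠ 0` a blocker ACTIVE at `e` (`⟪e, w⟫ = ‖w‖²/2`: the ball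
at `y + e` touches `y + w`) and respected by `u` (`⟪u, w⟫ ≤ ‖w‖²/2`); `t = u − ⟪u, e⟫e` the tangential part of `u` at `e`.  If the
blocker pushes in the direction of `t` by at least `μ ≥ 0`, i.e. `μ‖t‖·(‖w‖²/2) ≤ ⟪t, w⟫`, then `⟪u, e⟫ ≤ (1 − μ²)/(1 + μ²)` (`u` is at
angle `≥ 2 arctan μ` from `e`).  Proof: `⟪t, w⟫ = ⟪u, w⟫ − ⟪u, e⟫‖w‖²/2 ≤ (1 − ⟪u, e⟫)‖w‖²/2`, so `μ‖t‖ ≤ 1 − ⟪u, e⟫` with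
`‖t‖² = 1 − ⟪u, e⟫²`; square and divide by `1 − ⟪u, e⟫ > 0`. -/
theorem inner_le_pinThreshold_of_active {e u w : V} {μ : ℝ} (he : ‖e‖ = 1) (hu : ‖u‖ = 1) (hne : u ≠ e)
    (hw : w ≠ 0) (hact : ⟪e, w⟫_ℝ = ‖w‖ ^ 2 / 2) (hfree : ⟪u, w⟫_ℝ ≤ ‖w‖ ^ 2 / 2) (hμ : 0 ≤ μ)
    (hpush : μ * ‖u - ⟪u, e⟫_ℝ • e‖ * (‖w‖ ^ 2 / 2) ≤ ⟪u - ⟪u, e⟫_ℝ • e, w⟫_ℝ) :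
    ⟪u, e⟫_ℝ ≤ (1 - μ ^ 2) / (1 + μ ^ 2) := by
  set a := ⟪u, e⟫_ℝ with ha
  set t := u - a • e with ht
  have hee : ⟪e, e⟫_ℝ = 1 := by rw [real_inner_self_eq_norm_sq, he, one_pow]
  have huu : ⟪u, u⟫_ℝ = 1 := by rw [real_inner_self_eq_norm_sq, hu, one_pow]
  have heu : ⟪e, u⟫_ℝ = a := real_inner_comm u e
  have ht2 : ‖t‖ ^ 2 = 1 - a ^ 2 := by
    rw [← real_inner_self_eq_norm_sq]
    simp only [ht, inner_sub_left, inner_sub_right, real_inner_smul_left, real_inner_smul_right, hee, huu, heu, ← ha]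
    ring
  have htw : ⟪t, w⟫_ℝ = ⟪u, w⟫_ℝ - a * (‖w‖ ^ 2 / 2) := by
    simp only [ht, inner_sub_left, real_inner_smul_left, hact]
  have hW : 0 < ‖w‖ ^ 2 / 2 := by
    have := norm_pos_iff.2 hw
    positivity
  have h1 : μ * ‖t‖ ≤ 1 - a := by
    have h : μ * ‖t‖ * (‖w‖ ^ 2 / 2) ≤ (1 - a) * (‖w‖ ^ 2 / 2) := by
      rw [htw] at hpush
      nlinarith
    exact le_of_mul_le_mul_right h hW
  have ha1 : a < 1 := by
    have hle : a ≤ 1 := by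
      have h := real_inner_le_norm u e
      rw [hu, he, one_mul] at h
      exact h
    rcases hle.lt_or_eq with h | h
    · exact h
    · exfalso
      apply hne
      have h0 : ‖t‖ ^ 2 = 0 := by rw [ht2, h]; ring
      have ht0 : t = 0 := by rwa [sq_eq_zero_iff, norm_eq_zero] at h0
      have hu' : u = t + a • e := by rw [ht]; abel
      rw [hu', ht0, h, one_smul, zero_add]
  have h2 : μ ^ 2 * (1 - a ^ 2) ≤ (1 - a) ^ 2 := by
    have h := mul_self_le_mul_self (by positivity : 0 ≤ μ * ‖t‖) h1
    rw [← ht2]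
    nlinarith [h]
  have h3 : μ ^ 2 * (1 + a) ≤ 1 - a := by
    have h1a : 0 < 1 - a := by linarith
    have h : μ ^ 2 * (1 + a) * (1 - a) ≤ (1 - a) * (1 - a) := by nlinarith [h2]
    exact le_of_mul_le_mul_right h h1a
  rw [le_div_iff₀ (by positivity : (0 : ℝ) < 1 + μ ^ 2)]
  nlinarith [h3]

/-- **(L3) pin lemma, support form.**  `e` a unit vector; `A` a set of nonzero blockers active at `e` (`⟪e, w⟫ = ‖w‖²/2`); suppose every
nonzero tangent vector `d ⊥ e` is pushed by some active blocker by at least `μ ≥ 0`: `μ‖d‖‖w‖²/2 ≤ ⟪d, w⟫` («the tangent hull of the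
active blockers contains `0` strictly, with in-radius `μ`»).  Then every unit `u ≠ e` that respects all of `A` (`⟪u, w⟫ ≤ ‖w‖²/2`) has
`⟪u, e⟫ ≤ (1 − μ²)/(1 + μ²)`. -/
theorem inner_le_pinThreshold {e u : V} {A : Set V} {μ : ℝ} (he : ‖e‖ = 1) (hu : ‖u‖ = 1) (hne : u ≠ e)
    (hμ : 0 ≤ μ) (hA : ∀ w ∈ A, w ≠ 0 ∧ ⟪e, w⟫_ℝ = ‖w‖ ^ 2 / 2)
    (hsupp : ∀ d : V, ⟪d, e⟫_ℝ = 0 → d ≠ 0 → ∃ w ∈ A, μ * ‖d‖ * (‖w‖ ^ 2 / 2) ≤ ⟪d, w⟫_ℝ)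
    (hfree : ∀ w ∈ A, ⟪u, w⟫_ℝ ≤ ‖w‖ ^ 2 / 2) :
    ⟪u, e⟫_ℝ ≤ (1 - μ ^ 2) / (1 + μ ^ 2) := by
  set a := ⟪u, e⟫_ℝ with ha
  set t := u - a • e with ht
  have hee : ⟪e, e⟫_ℝ = 1 := by rw [real_inner_self_eq_norm_sq, he, one_pow]
  by_cases ht0 : t = 0
  · -- `u = a • e` is a unit multiple of `e` other than `e`: the antipode
    have hu' : u = a • e := by
      have h : u = t + a • e := by rw [ht]; abel
      rw [h, ht0, zero_add]
    have habs : |a| = 1 := by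
      have h := congrArg norm hu'
      rw [norm_smul, he, hu, Real.norm_eq_abs, mul_one] at h
      exact h.symm
    rcases (abs_eq zero_le_one).1 habs with h | h
    · exact absurd (by rw [hu', h, one_smul]) hne
    · rw [h]
      exact neg_one_le_pinThreshold μ
  · have htd : ⟪t, e⟫_ℝ = 0 := by
      simp only [ht, inner_sub_left, real_inner_smul_left, hee, ← ha]
      ring
    obtain ⟨w, hwA, hw⟩ := hsupp t htd ht0
    exact inner_le_pinThreshold_of_active he hu hne (hA w hwA).1 (hA w hwA).2 (hfree w hwA) hμ hw

/-- **(L3), root-free support form.**  The same with the rational datum `ν = μ²`: the push hypothesis reads `0 ≤ ⟪d, w⟫` and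
`ν‖d‖²(‖w‖²/2)² ≤ ⟪d, w⟫²`, the conclusion `⟪u, e⟫ ≤ (1 − ν)/(1 + ν)`. -/
theorem inner_le_pinThreshold_sq {e u : V} {A : Set V} {ν : ℝ} (he : ‖e‖ = 1) (hu : ‖u‖ = 1) (hne : u ≠ e)
    (hν : 0 ≤ ν) (hA : ∀ w ∈ A, w ≠ 0 ∧ ⟪e, w⟫_ℝ = ‖w‖ ^ 2 / 2)
    (hsupp : ∀ d : V, ⟪d, e⟫_ℝ = 0 → d ≠ 0 → ∃ w ∈ A, 0 ≤ ⟪d, w⟫_ℝ ∧ ν * ‖d‖ ^ 2 * (‖w‖ ^ 2 / 2) ^ 2 ≤ ⟪d, w⟫_ℝ ^ 2)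
    (hfree : ∀ w ∈ A, ⟪u, w⟫_ℝ ≤ ‖w‖ ^ 2 / 2) :
    ⟪u, e⟫_ℝ ≤ (1 - ν) / (1 + ν) := by
  have hμ2 : Real.sqrt ν ^ 2 = ν := Real.sq_sqrt hν
  rw [← hμ2]
  refine inner_le_pinThreshold he hu hne (Real.sqrt_nonneg ν) hA (fun d hde hd0 => ?_) hfree
  obtain ⟨w, hwA, h0, hsq⟩ := hsupp d hde hd0
  refine ⟨w, hwA, ?_⟩
  have h1 : (Real.sqrt ν * ‖d‖ * (‖w‖ ^ 2 / 2)) ^ 2 ≤ ⟪d, w⟫_ℝ ^ 2 := by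
    calc (Real.sqrt ν * ‖d‖ * (‖w‖ ^ 2 / 2)) ^ 2 = ν * ‖d‖ ^ 2 * (‖w‖ ^ 2 / 2) ^ 2 := by rw [mul_pow, mul_pow, hμ2]
      _ ≤ ⟪d, w⟫_ℝ ^ 2 := hsq
  exact (sq_le_sq₀ (by positivity) h0).1 h1

/-- For a tangent vector `d ⊥ e`, the pairing with the scaled tangential part `a_w = (2/‖w‖²)(w − ⟪w, e⟫e)` of a blocker is
`⟪d, a_w⟫ = (2/‖w‖²)⟪d, w⟫`. -/
theorem inner_scaledTangent {e d w : V} (hd : ⟪d, e⟫_ℝ = 0) :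
    ⟪d, (2 / ‖w‖ ^ 2) • (w - ⟪w, e⟫_ℝ • e)⟫_ℝ = 2 / ‖w‖ ^ 2 * ⟪d, w⟫_ℝ := by
  rw [real_inner_smul_right, inner_sub_right, real_inner_smul_right, hd, mul_zero, sub_zero]

/-- **(L3) pin lemma, hull form** (cf-p2's phrasing in `capcc.pinned_exclusions`).  `e` unit; `A` a finite set of nonzero blockers active
at `e`; `a_w = (2/‖w‖²)(w − ⟪w, e⟫e)` their scaled tangential parts.  If the closed tangent disc of radius `μ ≥ 0` lies in the convex hull
of `{a_w : w ∈ A}` (every `d ⊥ e` with `‖d‖ ≤ μ` is in the hull) then every unit `u ≠ e` respecting `A` has `⟪u, e⟫ ≤ (1 − μ²)/(1 + μ²)`: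
the open pin cap `{x : ⟪x, e⟫ > (1 − μ²)/(1 + μ²)}` contains no free direction but `e`. -/
theorem inner_le_pinThreshold_of_disc_subset_hull [DecidableEq V] {e u : V} {A : Finset V} {μ : ℝ} (he : ‖e‖ = 1)
    (hu : ‖u‖ = 1) (hne : u ≠ e) (hμ : 0 ≤ μ) (hA : ∀ w ∈ A, w ≠ 0 ∧ ⟪e, w⟫_ℝ = ‖w‖ ^ 2 / 2)
    (hdisc : ∀ d : V, ⟪d, e⟫_ℝ = 0 → ‖d‖ ≤ μ →
      d ∈ convexHull ℝ (↑(A.image fun w => (2 / ‖w‖ ^ 2) • (w - ⟪w, e⟫_ℝ • e)) : Set V))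
    (hfree : ∀ w ∈ A, ⟪u, w⟫_ℝ ≤ ‖w‖ ^ 2 / 2) :
    ⟪u, e⟫_ℝ ≤ (1 - μ ^ 2) / (1 + μ ^ 2) := by
  refine inner_le_pinThreshold he hu hne hμ (fun w hw => hA w hw) (fun d hde hd0 => ?_) (fun w hw => hfree w hw)
  -- the point `μ • (‖d‖⁻¹ • d)` of the disc is a convex combination of the `a_w`
  have hdn : 0 < ‖d‖ := norm_pos_iff.2 hd0
  set d₁ := ‖d‖⁻¹ • d with hd₁
  have hd₁e : ⟪d₁, e⟫_ℝ = 0 := by rw [hd₁, real_inner_smul_left, hde, mul_zero]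
  have hd₁n : ‖d₁‖ = 1 := by
    rw [hd₁, norm_smul, norm_inv, norm_norm, inv_mul_cancel₀ (norm_ne_zero_iff.2 hd0)]
  have hmem : μ • d₁ ∈ convexHull ℝ (↑(A.image fun w => (2 / ‖w‖ ^ 2) • (w - ⟪w, e⟫_ℝ • e)) : Set V) := by
    apply hdisc
    · rw [real_inner_smul_left, hd₁e, mul_zero]
    · rw [norm_smul, hd₁n, mul_one, Real.norm_of_nonneg hμ]
  rw [Finset.mem_convexHull'] at hmem
  obtain ⟨l, hl0, hl1, hsum⟩ := hmem
  -- pair with `d₁`: `μ = ∑ l_x ⟪d₁, x⟫`, so some `x = a_w` has `μ ≤ ⟪d₁, a_w⟫`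
  have hpair : μ = ∑ x ∈ A.image (fun w => (2 / ‖w‖ ^ 2) • (w - ⟪w, e⟫_ℝ • e)), l x * ⟪d₁, x⟫_ℝ := by
    have h := congrArg (fun z => ⟪d₁, z⟫_ℝ) hsum
    simp only [inner_sum, real_inner_smul_right] at h
    rw [h, real_inner_self_eq_norm_sq, hd₁n, one_pow, mul_one]
  have hex : ∃ x ∈ A.image (fun w => (2 / ‖w‖ ^ 2) • (w - ⟪w, e⟫_ℝ • e)), μ ≤ ⟪d₁, x⟫_ℝ := by
    by_contra h
    push Not at h
    have hs : ∃ x ∈ A.image (fun w => (2 / ‖w‖ ^ 2) • (w - ⟪w, e⟫_ℝ • e)), 0 < l x := by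
      by_contra h'
      push Not at h'
      have : ∑ x ∈ A.image (fun w => (2 / ‖w‖ ^ 2) • (w - ⟪w, e⟫_ℝ • e)), l x ≤ 0 := Finset.sum_nonpos h'
      linarith
    obtain ⟨x₀, hx₀, hlx₀⟩ := hs
    have hlt : ∑ x ∈ A.image (fun w => (2 / ‖w‖ ^ 2) • (w - ⟪w, e⟫_ℝ • e)), l x * ⟪d₁, x⟫_ℝ <
        ∑ x ∈ A.image (fun w => (2 / ‖w‖ ^ 2) • (w - ⟪w, e⟫_ℝ • e)), l x * μ :=
      Finset.sum_lt_sum (fun x hx => mul_le_mul_of_nonneg_left (h x hx).le (hl0 x hx))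
        ⟨x₀, hx₀, mul_lt_mul_of_pos_left (h x₀ hx₀) hlx₀⟩
    rw [← Finset.sum_mul, hl1, one_mul] at hlt
    linarith
  obtain ⟨x, hx, hμx⟩ := hex
  rw [Finset.mem_image] at hx
  obtain ⟨w, hwA, rfl⟩ := hx
  refine ⟨w, hwA, ?_⟩
  have hwpos : 0 < ‖w‖ := norm_pos_iff.2 (hA w hwA).1
  -- `μ ≤ (2/‖w‖²)·‖d‖⁻¹·⟪d, w⟫`; clear denominators
  rw [inner_scaledTangent hd₁e, hd₁, real_inner_smul_left, div_mul_eq_mul_div, le_div_iff₀ (pow_pos hwpos 2)] at hμx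
  have h' : μ * ‖w‖ ^ 2 ≤ ‖d‖⁻¹ * (2 * ⟪d, w⟫_ℝ) := by
    calc μ * ‖w‖ ^ 2 ≤ 2 * (‖d‖⁻¹ * ⟪d, w⟫_ℝ) := hμx
      _ = ‖d‖⁻¹ * (2 * ⟪d, w⟫_ℝ) := by ring
  rw [le_inv_mul_iff₀ hdn] at h'
  nlinarith [h']

/-- **(L3), pin-cap form.**  Contrapositive packaging for the cover: under the support hypothesis, a unit vector in the OPEN pin cap
`{x : (1 − μ²)/(1 + μ²) < ⟪x, e⟫}` that respects every active blocker is `e` itself (so a pin cap contains no witness, `e` being a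
forbidden direction). -/
theorem eq_of_mem_pinCap {e u : V} {A : Set V} {μ : ℝ} (he : ‖e‖ = 1) (hu : ‖u‖ = 1) (hμ : 0 ≤ μ)
    (hA : ∀ w ∈ A, w ≠ 0 ∧ ⟪e, w⟫_ℝ = ‖w‖ ^ 2 / 2)
    (hsupp : ∀ d : V, ⟪d, e⟫_ℝ = 0 → d ≠ 0 → ∃ w ∈ A, μ * ‖d‖ * (‖w‖ ^ 2 / 2) ≤ ⟪d, w⟫_ℝ)
    (hfree : ∀ w ∈ A, ⟪u, w⟫_ℝ ≤ ‖w‖ ^ 2 / 2) (hcap : (1 - μ ^ 2) / (1 + μ ^ 2) < ⟪u, e⟫_ℝ) : u = e := by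
  by_contra hne
  have h := inner_le_pinThreshold he hu hne hμ hA hsupp hfree
  linarith

/-! ### (L4) Cross-cell conflict: the bilinear corner test -/

section Cross

variable {ι κ : Type*}

/-- A bilinear lower bound at corner pairs passes to pairs of convex combinations: `m ≤ ⟪p_i, q_j⟫` for all `i, j` gives
`m ≤ ⟪∑ α_i p_i, ∑ β_j q_j⟫`. -/
theorem le_inner_sum_smul_sum_smul {s : Finset ι} {t : Finset κ} {α : ι → ℝ} {β : κ → ℝ} {p : ι → V} {q : κ → V}
    {m : ℝ} (hα0 : ∀ i ∈ s, 0 ≤ α i) (hα1 : ∑ i ∈ s, α i = 1) (hβ0 : ∀ j ∈ t, 0 ≤ β j) (hβ1 : ∑ j ∈ t, β j = 1)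
    (hm : ∀ i ∈ s, ∀ j ∈ t, m ≤ ⟪p i, q j⟫_ℝ) :
    m ≤ ⟪∑ i ∈ s, α i • p i, ∑ j ∈ t, β j • q j⟫_ℝ := by
  refine le_inner_sum_smul hα0 hα1 fun i hi => ?_
  rw [real_inner_comm]
  exact le_inner_sum_smul hβ0 hβ1 fun j hj => by rw [real_inner_comm]; exact hm i hi j hj

/-- **The squared rational test for a pair**: `0 < m ≤ ⟪v, w⟫`, `‖v‖² ≤ M_a`, `‖w‖² ≤ M_b`, `M_a·M_b < 4m²` give `‖v‖‖w‖ < 2⟪v, w⟫`. -/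
theorem norm_mul_norm_lt_two_inner_of_test {v w : V} {m Ma Mb : ℝ} (hm0 : 0 < m) (hm : m ≤ ⟪v, w⟫_ℝ)
    (ha : ‖v‖ ^ 2 ≤ Ma) (hb : ‖w‖ ^ 2 ≤ Mb) (htest : Ma * Mb < 4 * m ^ 2) : ‖v‖ * ‖w‖ < 2 * ⟪v, w⟫_ℝ := by
  have h1 : (‖v‖ * ‖w‖) ^ 2 < (2 * m) ^ 2 := by
    rw [mul_pow]
    calc ‖v‖ ^ 2 * ‖w‖ ^ 2 ≤ Ma * Mb := mul_le_mul ha hb (sq_nonneg _) ((sq_nonneg _).trans ha)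
      _ < 4 * m ^ 2 := htest
      _ = (2 * m) ^ 2 := by ring
  have h2 : ‖v‖ * ‖w‖ < 2 * m := (sq_lt_sq₀ (by positivity) (by positivity)).1 h1
  linarith

/-- Normalised reading of `‖v‖‖w‖ < 2⟪v, w⟫`: the directions of `v, w` have inner product `> ½`. -/
theorem inner_normalize_gt_half {v w : V} (hv : v ≠ 0) (hw : w ≠ 0) (h : ‖v‖ * ‖w‖ < 2 * ⟪v, w⟫_ℝ) :
    1 / 2 < ⟪‖v‖⁻¹ • v, ‖w‖⁻¹ • w⟫_ℝ := by
  have hvw : 0 < ‖v‖ * ‖w‖ := mul_pos (norm_pos_iff.2 hv) (norm_pos_iff.2 hw)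
  rw [real_inner_smul_left, real_inner_smul_right, ← mul_assoc, ← mul_inv, lt_inv_mul_iff₀ hvw]
  linarith

/-- Normalised chord reading of `‖v‖‖w‖ < 2⟪v, w⟫`: the directions of `v, w` are at chord distance `< 1`. -/
theorem norm_normalize_sub_normalize_lt_one {v w : V} (hv : v ≠ 0) (hw : w ≠ 0)
    (h : ‖v‖ * ‖w‖ < 2 * ⟪v, w⟫_ℝ) : ‖‖v‖⁻¹ • v - ‖w‖⁻¹ • w‖ < 1 := by
  have hv1 : ‖‖v‖⁻¹ • v‖ = 1 := by
    rw [norm_smul, norm_inv, norm_norm, inv_mul_cancel₀ (norm_ne_zero_iff.2 hv)]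
  have hw1 : ‖‖w‖⁻¹ • w‖ = 1 := by
    rw [norm_smul, norm_inv, norm_norm, inv_mul_cancel₀ (norm_ne_zero_iff.2 hw)]
  exact (norm_sub_lt_one_iff hv1 hw1).2 (inner_normalize_gt_half hv hw h)

/-- **(L4) cross-cell conflict** (`capcc.cells_conflict(ca, cb)`).  Two cells with corner vectors `p_i` (`i ∈ s`) and `q_j` (`j ∈ t`): if
`m := min ⟪p_i, q_j⟫ > 0` and `4m² > max ‖p_i‖² · max ‖q_j‖²` — here: `0 < m ≤ ⟪p_i, q_j⟫`, `‖p_i‖² ≤ M_a`, `‖q_j‖² ≤ M_b`, `M_a M_b < 4m²` —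
then any direction of the first cell and any direction of the second are at chord distance `< 1` (angle `< 60°`), so the two cells cannot
both host a witness. -/
theorem cellsConflict {s : Finset ι} {t : Finset κ} {α : ι → ℝ} {β : κ → ℝ} {p : ι → V} {q : κ → V} {m Ma Mb : ℝ}
    (hα0 : ∀ i ∈ s, 0 ≤ α i) (hα1 : ∑ i ∈ s, α i = 1) (hβ0 : ∀ j ∈ t, 0 ≤ β j) (hβ1 : ∑ j ∈ t, β j = 1)
    (hm0 : 0 < m) (hm : ∀ i ∈ s, ∀ j ∈ t, m ≤ ⟪p i, q j⟫_ℝ) (hMa : ∀ i ∈ s, ‖p i‖ ^ 2 ≤ Ma)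
    (hMb : ∀ j ∈ t, ‖q j‖ ^ 2 ≤ Mb) (htest : Ma * Mb < 4 * m ^ 2) :
    (∑ i ∈ s, α i • p i) ≠ 0 ∧ (∑ j ∈ t, β j • q j) ≠ 0 ∧
      ‖‖∑ i ∈ s, α i • p i‖⁻¹ • (∑ i ∈ s, α i • p i) - ‖∑ j ∈ t, β j • q j‖⁻¹ • (∑ j ∈ t, β j • q j)‖ < 1 := by
  have h1 : m ≤ ⟪∑ i ∈ s, α i • p i, ∑ j ∈ t, β j • q j⟫_ℝ := le_inner_sum_smul_sum_smul hα0 hα1 hβ0 hβ1 hm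
  have hv : (∑ i ∈ s, α i • p i) ≠ 0 := by
    intro h0
    rw [h0, inner_zero_left] at h1
    linarith
  have hw : (∑ j ∈ t, β j • q j) ≠ 0 := by
    intro h0
    rw [h0, inner_zero_right] at h1
    linarith
  exact ⟨hv, hw, norm_normalize_sub_normalize_lt_one hv hw
    (norm_mul_norm_lt_two_inner_of_test hm0 h1 (norm_sq_sum_smul_le hα0 hα1 hMa)
      (norm_sq_sum_smul_le hβ0 hβ1 hMb) htest)⟩

end Cross

/-! ### Top-level bookkeeping: cover ⇒ capacity -/

/-- **Cover ⇒ capacity ≤ k.**  Blockers `B`, pins `P` (pairs `(e, c_e)` such that no free unit vector other than `e` has `⟪u, e⟫ > c_e`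
— discharged by (L3)), and `k` cover caps `(c_j, g_j)` of angular radius `< 30°`.  If every unit vector lies in an open blocker cap, an open
pin cap or a closed cover cap, then a finite family `T` of free unit vectors avoiding the pin directions, pairwise at chord distance `≥ 1`,
has at most `k` members. -/
theorem card_le_of_capCover {B : Set V} {P : Set (V × ℝ)} {k : ℕ} {c : Fin k → V} {g : Fin k → ℝ}
    {T : Finset V}
    (hpin : ∀ ec ∈ P, ∀ u : V, ‖u‖ = 1 → (∀ w ∈ B, ⟪u, w⟫_ℝ ≤ ‖w‖ ^ 2 / 2) → ec.2 < ⟪u, ec.1⟫_ℝ → u = ec.1)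
    (hg : ∀ j, 0 < g j) (hsmall : ∀ j, 3 * ‖c j‖ ^ 2 < 4 * g j ^ 2)
    (hcover : ∀ u : V, ‖u‖ = 1 →
      (∃ w ∈ B, ‖w‖ ^ 2 / 2 < ⟪u, w⟫_ℝ) ∨ (∃ ec ∈ P, ec.2 < ⟪u, ec.1⟫_ℝ) ∨ ∃ j, g j ≤ ⟪u, c j⟫_ℝ)
    (hT1 : ∀ u ∈ T, ‖u‖ = 1) (hTfree : ∀ u ∈ T, ∀ w ∈ B, ⟪u, w⟫_ℝ ≤ ‖w‖ ^ 2 / 2)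
    (hTpin : ∀ u ∈ T, ∀ ec ∈ P, u ≠ ec.1) (hsep : (T : Set V).Pairwise fun u v => 1 ≤ ‖u - v‖) :
    T.card ≤ k := by
  -- every witness lies in some cover cap
  have hcap : ∀ u ∈ T, ∃ j, g j ≤ ⟪u, c j⟫_ℝ := by
    intro u hu
    rcases hcover u (hT1 u hu) with ⟨w, hwB, hw⟩ | ⟨ec, hec, hu'⟩ | h
    · exact absurd (hTfree u hu w hwB) (not_le.2 hw)
    · exact absurd (hpin ec hec u (hT1 u hu) (hTfree u hu) hu') (hTpin u hu ec hec)
    · exact h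
  by_cases hk : k = 0
  · subst hk
    have hT : T = ∅ := by
      rw [Finset.eq_empty_iff_forall_notMem]
      intro u hu
      obtain ⟨j, -⟩ := hcap u hu
      exact j.elim0
    rw [hT, Finset.card_empty]
  haveI : Nonempty (Fin k) := ⟨⟨0, Nat.pos_of_ne_zero hk⟩⟩
  choose! f hf using hcap
  -- the cap index is injective on `T`
  have hinj : Set.InjOn f ↑T := by
    intro u hu v hv huv
    have hu' : g (f u) ≤ ⟪u, c (f u)⟫_ℝ := hf u hu
    have hv' : g (f u) ≤ ⟪v, c (f u)⟫_ℝ := by rw [huv]; exact hf v hv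
    exact smallCap_subsingleton (S := ↑T) hT1 hsep (hg (f u)) (hsmall (f u)) ⟨hu, hu'⟩ ⟨hv, hv'⟩
  calc T.card = (T.image f).card := (Finset.card_image_of_injOn hinj).symm
    _ ≤ (Finset.univ : Finset (Fin k)).card := Finset.card_le_card (Finset.subset_univ _)
    _ = k := by rw [Finset.card_univ, Fintype.card_fin]

omit [InnerProductSpace ℝ V] in
/-- **Patches ⇒ capacity ≤ K** (the clique refinement `capcc.patch_bound`).  Each witness `u ∈ T` is assigned a patch `f u : Fin k`; a patch
holds at most one witness (it lies in one small cap); `conflict a b` is a relation on patches such that witnesses in conflicting patches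
would be at chord distance `< 1` (discharged cell pair by cell pair via (L4)); and every set of pairwise non-conflicting patches has at
most `K` elements.  Then `T`, pairwise at chord distance `≥ 1`, has at most `K` members. -/
theorem card_le_of_patches {k K : ℕ} {T : Finset V} {f : V → Fin k} {conflict : Fin k → Fin k → Prop}
    (hinj : Set.InjOn f ↑T)
    (hconf : ∀ u ∈ T, ∀ v ∈ T, conflict (f u) (f v) → ‖u - v‖ < 1)
    (hK : ∀ S : Finset (Fin k), (↑S : Set (Fin k)).Pairwise (fun a b => ¬ conflict a b) → S.card ≤ K)
    (hsep : (T : Set V).Pairwise fun u v => 1 ≤ ‖u - v‖) :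
    T.card ≤ K := by
  have hpw : (↑(T.image f) : Set (Fin k)).Pairwise fun a b => ¬ conflict a b := by
    intro a ha b hb hab hc
    rw [Finset.coe_image] at ha hb
    obtain ⟨u, hu, rfl⟩ := ha
    obtain ⟨v, hv, rfl⟩ := hb
    have huv : u ≠ v := fun h => hab (by rw [h])
    have h1 := hsep hu hv huv
    have h2 := hconf u hu v hv hc
    linarith
  calc T.card = (T.image f).card := (Finset.card_image_of_injOn hinj).symm
    _ ≤ K := hK _ hpw


end CapChecker

end Summit.Ventures.Crystal3D.Theorems
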